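import Mathlib.Analysis.InnerProductSpace.ProdL2
import Mathlib.Analysis.InnerProductSpace.PiL2

/-!
# Orthogonal sum of two configurations: cardinality, norms and energy (generic bookkeeping)

Framing: lottery ticket; floor = certified bounds/negative ranges. Venture `PackingBounds` (cell `pub-packcert`, seat
`pub-packcert-energy`, gen 26) — attained-side infrastructure.

For finite configurations `A ⊂ E`, `B ⊂ F` of unit vectors in real inner product spaces, the configuration
`A ⊕ B := {(x, 0)} ∪ {(0, y)} ⊂ E ⊕ F` (the `L²` product `WithLp 2 (E × F)`) consists of `|A| + |B|` unit vectors, and for every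
potential `a`: `Σ_{z ≠ w ∈ A ⊕ B} a(⟪z,w⟫) = E_a(A) + E_a(B) + 2|A||B|·a(0)` (`energy_osum`). A linear isometry equivalence onto
`ℝⁿ` (`n = dim E + dim F`) transports cardinality, norms and energies (`exists_transfer_osum`). Used for the competitor family
`X_n = X_5 ⊕ β_{n-5}` of the diplo-simplex conjectures (`Conjectures/DiploSimplexPetersenCross.lean`).
-/

noncomputable section

open Finset WithLp Module
open scoped RealInnerProductSpace

namespace Summit.Ventures.PackingBounds.Config.OrthogonalSum

variable {E F : Type*} [NormedAddCommGroup E] [InnerProductSpace ℝ E] [NormedAddCommGroup F] [InnerProductSpace ℝ F]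

/-- Left inclusion `x ↦ (x, 0)` into the `L²` product. -/
def inl (x : E) : WithLp 2 (E × F) := toLp 2 (x, 0)

/-- Right inclusion `y ↦ (0, y)` into the `L²` product. -/
def inr (y : F) : WithLp 2 (E × F) := toLp 2 (0, y)

omit [NormedAddCommGroup E] [InnerProductSpace ℝ E] [InnerProductSpace ℝ F] in
/-- `inl` is injective. -/
theorem inl_injective : Function.Injective (inl : E → WithLp 2 (E × F)) := fun x y h => by
  have := congrArg (fun z : WithLp 2 (E × F) => (ofLp z).fst) h
  simpa [inl] using this

omit [NormedAddCommGroup F] [InnerProductSpace ℝ E] [InnerProductSpace ℝ F] in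
/-- `inr` is injective. -/
theorem inr_injective : Function.Injective (inr : F → WithLp 2 (E × F)) := fun x y h => by
  have := congrArg (fun z : WithLp 2 (E × F) => (ofLp z).snd) h
  simpa [inr] using this

/-- `⟪(x,0),(x',0)⟫ = ⟪x,x'⟫`. -/
@[simp] theorem inner_inl_inl (x x' : E) : inner ℝ (inl x : WithLp 2 (E × F)) (inl x') = inner ℝ x x' := by
  simp [inl, WithLp.prod_inner_apply]

/-- `⟪(0,y),(0,y')⟫ = ⟪y,y'⟫`. -/
@[simp] theorem inner_inr_inr (y y' : F) : inner ℝ (inr y : WithLp 2 (E × F)) (inr y') = inner ℝ y y' := by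
  simp [inr, WithLp.prod_inner_apply]

/-- `⟪(x,0),(0,y)⟫ = 0`. -/
@[simp] theorem inner_inl_inr (x : E) (y : F) : inner ℝ (inl x : WithLp 2 (E × F)) (inr y) = 0 := by
  simp [inl, inr, WithLp.prod_inner_apply]

/-- `⟪(0,y),(x,0)⟫ = 0`. -/
@[simp] theorem inner_inr_inl (x : E) (y : F) : inner ℝ (inr y : WithLp 2 (E × F)) (inl x) = 0 := by
  simp [inl, inr, WithLp.prod_inner_apply]

/-- `‖(x,0)‖ = ‖x‖`. -/
theorem norm_inl (x : E) : ‖(inl x : WithLp 2 (E × F))‖ = ‖x‖ := by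
  have h := inner_inl_inl (F := F) x x
  rw [real_inner_self_eq_norm_sq, real_inner_self_eq_norm_sq] at h
  nlinarith [norm_nonneg (inl x : WithLp 2 (E × F)), norm_nonneg x, h]

/-- `‖(0,y)‖ = ‖y‖`. -/
theorem norm_inr (y : F) : ‖(inr y : WithLp 2 (E × F))‖ = ‖y‖ := by
  have h := inner_inr_inr (E := E) y y
  rw [real_inner_self_eq_norm_sq, real_inner_self_eq_norm_sq] at h
  nlinarith [norm_nonneg (inr y : WithLp 2 (E × F)), norm_nonneg y, h]

/-- A unit vector on the left is never a vector on the right. -/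
theorem inl_ne_inr {x : E} (hx : ‖x‖ = 1) (y : F) : (inl x : WithLp 2 (E × F)) ≠ inr y := by
  intro h
  have h1 : inner ℝ (inl x : WithLp 2 (E × F)) (inl x) = inner ℝ (inl x : WithLp 2 (E × F)) (inr y) := by rw [← h]
  rw [inner_inl_inl, inner_inl_inr, real_inner_self_eq_norm_sq, hx] at h1
  norm_num at h1

variable [DecidableEq E] [DecidableEq F] [DecidableEq (WithLp 2 (E × F))]

/-- The orthogonal sum configuration `{(x,0) : x ∈ A} ∪ {(0,y) : y ∈ B}`. -/
def osum (A : Finset E) (B : Finset F) : Finset (WithLp 2 (E × F)) := A.image inl ∪ B.image inr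

omit [DecidableEq E] [DecidableEq F] in
/-- For unit vectors on the left, the two halves are disjoint. -/
theorem disjoint_images (A : Finset E) (B : Finset F) (hA : ∀ x ∈ A, ‖x‖ = 1) :
    Disjoint (A.image (inl : E → WithLp 2 (E × F))) (B.image inr) := by
  rw [Finset.disjoint_left]
  intro z hz hz'
  obtain ⟨x, hx, rfl⟩ := mem_image.1 hz
  obtain ⟨y, _, hy⟩ := mem_image.1 hz'
  exact inl_ne_inr (hA x hx) y hy.symm

omit [DecidableEq E] [DecidableEq F] in
/-- `|A ⊕ B| = |A| + |B|`. -/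
theorem card_osum (A : Finset E) (B : Finset F) (hA : ∀ x ∈ A, ‖x‖ = 1) :
    (osum A B).card = A.card + B.card := by
  rw [osum, card_union_of_disjoint (disjoint_images A B hA), card_image_of_injective _ inl_injective,
    card_image_of_injective _ inr_injective]

omit [DecidableEq E] [DecidableEq F] in
/-- Every point of `A ⊕ B` is a unit vector. -/
theorem norm_osum (A : Finset E) (B : Finset F) (hA : ∀ x ∈ A, ‖x‖ = 1) (hB : ∀ y ∈ B, ‖y‖ = 1) :
    ∀ z ∈ osum A B, ‖z‖ = 1 := by
  intro z hz
  rcases mem_union.1 hz with h | h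
  · obtain ⟨x, hx, rfl⟩ := mem_image.1 h; rw [norm_inl, hA x hx]
  · obtain ⟨y, hy, rfl⟩ := mem_image.1 h; rw [norm_inr, hB y hy]

/-- **Energy of the orthogonal sum**: `E_a(A ⊕ B) = E_a(A) + E_a(B) + 2|A||B| a(0)`. -/
theorem energy_osum (A : Finset E) (B : Finset F) (hA : ∀ x ∈ A, ‖x‖ = 1) (a : ℝ → ℝ) :
    ∑ z ∈ osum A B, ∑ w ∈ (osum A B).erase z, a (inner ℝ z w) =
      (∑ x ∈ A, ∑ x' ∈ A.erase x, a (inner ℝ x x')) + (∑ y ∈ B, ∑ y' ∈ B.erase y, a (inner ℝ y y')) +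
        2 * (A.card : ℝ) * B.card * a 0 := by
  have hdis := disjoint_images A B hA
  have hinl : Function.Injective (inl : E → WithLp 2 (E × F)) := inl_injective
  have hinr : Function.Injective (inr : F → WithLp 2 (E × F)) := inr_injective
  rw [osum, sum_union hdis, sum_image fun x _ y _ h => hinl h, sum_image fun x _ y _ h => hinr h]
  -- inner sums for a left point
  have hL : ∀ x ∈ A, ∑ w ∈ (A.image inl ∪ B.image inr).erase (inl x : WithLp 2 (E × F)), a (inner ℝ (inl x) w) =
      (∑ x' ∈ A.erase x, a (inner ℝ x x')) + (B.card : ℝ) * a 0 := by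
    intro x hx
    have hnot : (inl x : WithLp 2 (E × F)) ∉ B.image inr := fun h => by
      obtain ⟨y, _, hy⟩ := mem_image.1 h; exact inl_ne_inr (hA x hx) y hy.symm
    rw [erase_union_distrib, erase_eq_of_notMem hnot, ← image_erase hinl,
      sum_union (disjoint_images (A.erase x) B fun y hy => hA y (mem_of_mem_erase hy)),
      sum_image fun x _ y _ h => hinl h, sum_image fun x _ y _ h => hinr h]
    simp only [inner_inl_inl, inner_inl_inr, sum_const, nsmul_eq_mul]
  have hR : ∀ y ∈ B, ∑ w ∈ (A.image inl ∪ B.image inr).erase (inr y : WithLp 2 (E × F)), a (inner ℝ (inr y) w) =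
      (A.card : ℝ) * a 0 + ∑ y' ∈ B.erase y, a (inner ℝ y y') := by
    intro y hy
    have hnot : (inr y : WithLp 2 (E × F)) ∉ A.image inl := fun h => by
      obtain ⟨x, hx, hx'⟩ := mem_image.1 h; exact inl_ne_inr (hA x hx) y hx'
    rw [erase_union_distrib, erase_eq_of_notMem hnot, ← image_erase hinr,
      sum_union (disjoint_images A (B.erase y) hA),
      sum_image fun x _ y _ h => hinl h, sum_image fun x _ y _ h => hinr h]
    simp only [inner_inr_inl, inner_inr_inr, sum_const, nsmul_eq_mul]
  rw [sum_congr rfl hL, sum_congr rfl hR, sum_add_distrib, sum_add_distrib, sum_const, sum_const, nsmul_eq_mul,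
    nsmul_eq_mul]
  ring

/-- **Transfer to `ℝⁿ`.** If `dim E + dim F = n` (finite-dimensional), the orthogonal sum of `A` and `B` has an isometric copy in
`ℝⁿ`: `|A| + |B|` unit vectors with `a`-energy `E_a(A) + E_a(B) + 2|A||B| a(0)` for every potential `a`. -/
theorem exists_transfer_osum [FiniteDimensional ℝ E] [FiniteDimensional ℝ F] {n : ℕ}
    (hn : finrank ℝ E + finrank ℝ F = n) (A : Finset E) (B : Finset F) (hA : ∀ x ∈ A, ‖x‖ = 1)
    (hB : ∀ y ∈ B, ‖y‖ = 1) :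
    ∃ C : Finset (EuclideanSpace ℝ (Fin n)), C.card = A.card + B.card ∧ (∀ z ∈ C, ‖z‖ = 1) ∧
      ∀ a : ℝ → ℝ, ∑ z ∈ C, ∑ w ∈ C.erase z, a (inner ℝ z w) =
        (∑ x ∈ A, ∑ x' ∈ A.erase x, a (inner ℝ x x')) + (∑ y ∈ B, ∑ y' ∈ B.erase y, a (inner ℝ y y')) +
          2 * (A.card : ℝ) * B.card * a 0 := by
  classical
  have hW : finrank ℝ (WithLp 2 (E × F)) = n := by
    rw [← hn, (WithLp.linearEquiv 2 ℝ (E × F)).finrank_eq, finrank_prod]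
  let b : OrthonormalBasis (Fin n) ℝ (WithLp 2 (E × F)) := (stdOrthonormalBasis ℝ (WithLp 2 (E × F))).reindex (finCongr hW)
  let Φ : WithLp 2 (E × F) ≃ₗᵢ[ℝ] EuclideanSpace ℝ (Fin n) := b.repr
  have hinj : Function.Injective Φ := Φ.injective
  refine ⟨(osum A B).image Φ, ?_, ?_, fun a => ?_⟩
  · rw [card_image_of_injective _ hinj, card_osum A B hA]
  · intro z hz
    obtain ⟨w, hw, rfl⟩ := mem_image.1 hz
    rw [LinearIsometryEquiv.norm_map, norm_osum A B hA hB w hw]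
  · rw [sum_image fun x _ y _ h => hinj h, ← energy_osum A B hA a]
    refine sum_congr rfl fun z _ => ?_
    rw [← image_erase hinj, sum_image fun x _ y _ h => hinj h]
    refine sum_congr rfl fun w _ => ?_
    rw [LinearIsometryEquiv.inner_map_map]

end Summit.Ventures.PackingBounds.Config.OrthogonalSum

end
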